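import Mathlib
import Literature.Barriers.ValiantsHypothesis.AlgebraicNaturalProofs
import Literature.Computability.AlgebraicComplexity.ArithCircuitProofs
import Summits.ValiantsHypothesis.ValiantsHypothesis.Theorems.BarrierLeverSuccinctHittingSetsForVPSparse
import HarnessLib

/-!
# Crux `BarrierLever.SuccinctHittingSetsForVP` (stmt-ValiantsHypothesis-14610), line `registered` —
GENERATOR ASSEMBLY (registered stub `stub_generatorGlue`)

**What is proved (it does NOT close the item).** The registered glue stub `stub_generatorGlue` of the
skeleton `Cruxes/SuccinctHittingSetsForVP/Lines/birth.lean` (wave 2, the sparse half in GENERATOR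
form): GIVEN the statements of the three neighbour stubs — rank-one coefficient tensors
`∏_i c_i(μ_i)` are coefficient vectors of circuits in `SmallCircuits ℂ n 8` (`stub_separableCoeff`,
FSV18 Construction 25 in regime `d = n`), the abstract hitting lemma of the succinct
Shpilka–Volkovich generator (`stub_svHit`, FSV18 Lemma 28/31) and Lagrange indicators `ℓ_k` of the
grid `{0, …, n}` (`stub_lagrangeIndicator`) — for every sparsity exponent `a`, for all `n ≥ 8a + 8`,
the shifted succinct SV generator
`Γ_μ(W, Z) = coeff_μ f₀ + Σ_{j < t} W_j · ∏_i ℓ_{μ_i}(Z_{j,i})` (`t = 2an`, `f₀` the full-support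
circuit of `stub_fullSupport`) has image inside `coeff(SmallCircuits ℂ n 10)` and is annihilated by
NO nonzero polynomial in the `N = C(2n,n)` coefficient variables with at most `N^a` monomials:
Forbes–Shpilka–Volk 2018 Construction 29 / Cor. 34 (generator form) in the tree's regime `d = n`.

Mechanism. Realisability: at a point `p = (w, z)` the value `Γ(p)` is the coefficient vector of
`f₀ + Σ_j w_j Λ_j`, `Λ_j ∈ SmallCircuits ℂ n 8` the circuit of G1 for the table
`c_i(k) = ℓ_k(z_{j,i})`; its size is `≤ n³ + t(n⁸ + 2) + 1 ≤ n^10` for `n ≥ 8a + 8`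
(`GeneratorGlue.size_budget`). Hitting: by FSV Lemma 32 at `coeff f₀` (landed
`Sparse.exists_narrow_monomial_shift`) the shift `D(coeff f₀ + ·)` of a nonzero `N^a`-sparse `D` has
a monomial `m` with `2^|supp m| ≤ |supp D| ≤ N^a ≤ 2^t`, so `|supp m| ≤ t`; a supported non-root
(`LowSupport.exists_eval_ne_zero_supported`, `ShiftedSupport.eval_shift`) is the witness G2 asks for,
the indicator property `L_μ(ν) = ∏_i ℓ_{μ_i}(ν_i) = [μ = ν]` holding because all coordinates of a
degree-`≤ n` exponent vector are `≤ n`. Axioms: `propext`, `Classical.choice`, `Quot.sound`.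
References: [ForbesShpilkaVolk2018] Construction 25/29, Lemma 28, 31, 32, Cor. 34.
-/

-- layout Summits/ValiantsHypothesis/ValiantsHypothesis forces the duplicated namespace component
set_option linter.dupNamespace false

namespace Summit.ValiantsHypothesis.ValiantsHypothesis.Theorems.BarrierLever.SuccinctHittingSetsForVP

open Literature.Barriers.ValiantsHypothesis Literature.Computability.AlgebraicComplexity MvPolynomial

namespace GeneratorGlue

/-- The size budget of the realisation: for `n ≥ 8a + 8`, `n³ + (2an(n⁸ + 1) + 2an) + 1 ≤ n^10`.
[folklore] -/
theorem size_budget {a n : ℕ} (hn : 8 * a + 8 ≤ n) :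
    n ^ 3 + (2 * a * n * (n ^ 8 + 1) + 2 * a * n) + 1 ≤ n ^ 10 := by
  have h1 : 1 ≤ n := by omega
  have h8 : 2 ≤ n ^ 8 := le_trans (by omega : 2 ≤ n) (Nat.le_self_pow (by norm_num) n)
  have h3 : n ^ 3 + 1 ≤ n ^ 9 :=
    calc n ^ 3 + 1 ≤ n ^ 3 + n ^ 3 := by gcongr; exact Nat.one_le_pow _ _ h1
      _ = 2 * n ^ 3 := by ring
      _ ≤ n * n ^ 3 := Nat.mul_le_mul_right _ (by omega)
      _ = n ^ 4 := by ring
      _ ≤ n ^ 9 := Nat.pow_le_pow_right h1 (by norm_num)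
  calc n ^ 3 + (2 * a * n * (n ^ 8 + 1) + 2 * a * n) + 1
      = (n ^ 3 + 1) + 2 * a * n * (n ^ 8 + 2) := by ring
    _ ≤ n ^ 9 + 2 * a * n * (n ^ 8 + n ^ 8) := by gcongr
    _ = (4 * a + 1) * n ^ 9 := by ring
    _ ≤ n * n ^ 9 := Nat.mul_le_mul_right _ (by omega)
    _ = n ^ 10 := by ring

/-- The sparsity budget in support form: `|supp D| ≤ C(2n,n)^a` and `2^|S| ≤ |supp D|` give
`|S| ≤ 2an`. [folklore] -/
theorem card_le_of_two_pow_le {a n s d : ℕ} (hs : 2 ^ s ≤ d) (hd : d ≤ Nat.choose (2 * n) n ^ a) :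
    s ≤ 2 * a * n :=
  (Nat.pow_le_pow_iff_right (by norm_num)).mp (hs.trans (hd.trans SparseGlue.choose_pow_le))

variable {n : ℕ}

/-- **Realisability of the generator (size and degree).** If `f₀ ∈ SmallCircuits ℂ n b₀`, every
`Λ_j ∈ SmallCircuits ℂ n b₁` (`j < t`) and `n^b₀ + (t(n^b₁ + 1) + t) + 1 ≤ n^b`, then
`f₀ + Σ_j c_j Λ_j ∈ SmallCircuits ℂ n b`. [cite: ForbesShpilkaVolk2018, Construction 29] -/
theorem add_sum_mem_smallCircuits {b₀ b₁ b t : ℕ}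
    (h : n ^ b₀ + (t * (n ^ b₁ + 1) + t) + 1 ≤ n ^ b)
    {f₀ : MvPolynomial (Fin n) ℂ} (hf₀ : f₀ ∈ SmallCircuits ℂ n b₀)
    {Λ : Fin t → MvPolynomial (Fin n) ℂ} (hΛ : ∀ j, Λ j ∈ SmallCircuits ℂ n b₁) (c : Fin t → ℂ) :
    f₀ + ∑ j : Fin t, C (c j) * Λ j ∈ SmallCircuits ℂ n b := by
  refine ⟨(totalDegree_add _ _).trans (max_le hf₀.1 (totalDegree_finsetSum_le fun j _ => ?_)), ?_⟩
  · calc (C (c j) * Λ j).totalDegree ≤ (C (c j) : MvPolynomial (Fin n) ℂ).totalDegree +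
          (Λ j).totalDegree := totalDegree_mul _ _
      _ ≤ n := by rw [totalDegree_C, zero_add]; exact (hΛ j).1
  · calc complexity (f₀ + ∑ j : Fin t, C (c j) * Λ j)
        ≤ complexity f₀ + complexity (∑ j : Fin t, C (c j) * Λ j) + 1 := complexity_add_le_holds _ _
      _ ≤ n ^ b₀ + (∑ j : Fin t, complexity (C (c j) * Λ j) +
            (Finset.univ : Finset (Fin t)).card) + 1 := by
          gcongr
          · exact hf₀.2
          · exact complexity_finset_sum_le _ _
      _ ≤ n ^ b₀ + (∑ _j : Fin t, (n ^ b₁ + 1) + t) + 1 := by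
          gcongr with j _
          · calc complexity (C (c j) * Λ j)
                ≤ complexity (C (c j) : MvPolynomial (Fin n) ℂ) + complexity (Λ j) + 1 :=
                  complexity_mul_le_holds _ _
              _ ≤ 0 + n ^ b₁ + 1 := by
                  rw [complexity_C_holds]
                  gcongr
                  exact (hΛ j).2
              _ = n ^ b₁ + 1 := by ring
          · rw [Finset.card_univ, Fintype.card_fin]
      _ = n ^ b₀ + (t * (n ^ b₁ + 1) + t) + 1 := by
          rw [Finset.sum_const, Finset.card_univ, Fintype.card_fin, smul_eq_mul]
      _ ≤ n ^ b := h

/-- **Realisability of the generator (coefficients).** The coefficient vector of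
`f₀ + Σ_j c_j Λ_j` is `coeff f₀ + Σ_j c_j coeff Λ_j`. [folklore] -/
theorem coeff_add_sum {t : ℕ} (f₀ : MvPolynomial (Fin n) ℂ) (Λ : Fin t → MvPolynomial (Fin n) ℂ)
    (c : Fin t → ℂ) (m : Fin n →₀ ℕ) :
    coeff m (f₀ + ∑ j : Fin t, C (c j) * Λ j) = coeff m f₀ + ∑ j : Fin t, c j * coeff m (Λ j) := by
  rw [coeff_add, coeff_sum]
  simp only [coeff_C_mul]

/-- Evaluating one coordinate of the shifted succinct SV generator
`Γ = y + Σ_j W_j · L(Z_j)` at a point `p = (w, z)`: `y + Σ_j w_j L(z_j)`.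
[cite: ForbesShpilkaVolk2018, Construction 29] -/
theorem eval_generator {Z : Type*} {t : ℕ} (y : ℂ) (L : MvPolynomial Z ℂ)
    (p : Fin t ⊕ (Fin t × Z) → ℂ) :
    eval p (C y + ∑ j : Fin t, X (Sum.inl j) * rename (fun z => Sum.inr (j, z)) L) =
      y + ∑ j : Fin t, p (Sum.inl j) * eval (fun z => p (Sum.inr (j, z))) L := by
  simp only [map_add, eval_C, map_sum, map_mul, eval_X, eval_rename]
  rfl

/-- Evaluating a univariate polynomial planted in the variable `X i`:
`(q(X_i))(x) = q(x_i)`. [folklore] -/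
theorem eval_polynomial_aeval_X (q : Polynomial ℂ) (i : Fin n) (x : Fin n → ℂ) :
    eval x (Polynomial.aeval (X i : MvPolynomial (Fin n) ℂ) q) = q.eval (x i) := by
  have h := Polynomial.aeval_algHom_apply (MvPolynomial.aeval x : MvPolynomial (Fin n) ℂ →ₐ[ℂ] ℂ)
    (X i : MvPolynomial (Fin n) ℂ) q
  rw [MvPolynomial.aeval_X, MvPolynomial.aeval_eq_eval] at h
  rw [← h, Polynomial.coe_aeval_eq_eval]

/-- Evaluating a product of planted univariates: `(∏_i q_i(X_i))(x) = ∏_i q_i(x_i)`. [folklore] -/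
theorem eval_prod_aeval (q : Fin n → Polynomial ℂ) (x : Fin n → ℂ) :
    eval x (∏ i : Fin n, Polynomial.aeval (X i : MvPolynomial (Fin n) ℂ) (q i)) =
      ∏ i : Fin n, (q i).eval (x i) := by
  rw [map_prod]
  exact Finset.prod_congr rfl fun i _ => eval_polynomial_aeval_X (q i) i x

/-- **The indicator property of the succinct Lagrange products** (FSV Construction 25 with the
Lagrange indicators of `{0, …, n}`): for exponent vectors `μ, ν` of degree `≤ n`,
`∏_i ℓ_{μ_i}(ν_i) = [μ = ν]`, all coordinates being `≤ n`.
[cite: ForbesShpilkaVolk2018, Construction 25 and Lemma 28] -/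
theorem eval_indicator {ℓ : ℕ → Polynomial ℂ}
    (hℓ : ∀ k k' : ℕ, k ≤ n → k' ≤ n → (ℓ k).eval (k' : ℂ) = if k = k' then 1 else 0)
    (μ ν : degLEMonomials n) :
    eval (fun i => (((ν : Fin n →₀ ℕ) i : ℕ) : ℂ))
        (∏ i : Fin n, Polynomial.aeval (X i : MvPolynomial (Fin n) ℂ) (ℓ ((μ : Fin n →₀ ℕ) i))) =
      if μ = ν then 1 else 0 := by
  rw [eval_prod_aeval]
  have hμ : ∀ i, (μ : Fin n →₀ ℕ) i ≤ n := fun i => (Finsupp.le_degree i (μ : Fin n →₀ ℕ)).trans μ.2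
  have hν : ∀ i, (ν : Fin n →₀ ℕ) i ≤ n := fun i => (Finsupp.le_degree i (ν : Fin n →₀ ℕ)).trans ν.2
  have hfac : ∀ i, (ℓ ((μ : Fin n →₀ ℕ) i)).eval (((ν : Fin n →₀ ℕ) i : ℕ) : ℂ) =
      if (μ : Fin n →₀ ℕ) i = (ν : Fin n →₀ ℕ) i then 1 else 0 := fun i => hℓ _ _ (hμ i) (hν i)
  simp only [hfac]
  by_cases h : μ = ν
  · subst h
    simp only [if_true, Finset.prod_const_one]
  · rw [if_neg h]
    have hex : ∃ i, (μ : Fin n →₀ ℕ) i ≠ (ν : Fin n →₀ ℕ) i := by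
      by_contra hcon
      push Not at hcon
      exact h (Subtype.ext (Finsupp.ext hcon))
    obtain ⟨i, hi⟩ := hex
    exact Finset.prod_eq_zero (Finset.mem_univ i) (if_neg hi)

end GeneratorGlue

/-- **Registered stub `stub_generatorGlue`** (crux stmt-ValiantsHypothesis-14610, line `registered`;
generator assembly): from the succinctness of rank-one coefficient tensors (G1), the abstract hitting
lemma of the succinct Shpilka–Volkovich generator (G2) and Lagrange indicators of `{0, …, n}` (G3),
for every sparsity exponent `a`, eventually in `n` (`n ≥ 8a + 8`), the shifted succinct SV generator
`Γ_μ = coeff_μ f₀ + Σ_{j < 2an} W_j ∏_i ℓ_{μ_i}(Z_{j,i})` has image inside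
`coeff(SmallCircuits ℂ n 10)` and is annihilated by no nonzero polynomial with at most `C(2n,n)^a`
monomials. [cite: ForbesShpilkaVolk2018, Construction 29 and Cor. 34] -/
theorem stub_generatorGlue :
    (∀ n : ℕ, 8 ≤ n → ∀ c : Fin n → ℕ → ℂ,
      ∃ Λ ∈ SmallCircuits ℂ n 8, ∀ μ : degLEMonomials n,
        MvPolynomial.coeff (μ : Fin n →₀ ℕ) Λ = ∏ i : Fin n, c i ((μ : Fin n →₀ ℕ) i)) →
    (∀ (ι : Type) [DecidableEq ι] (Z : Type) (t : ℕ) (L : ι → MvPolynomial Z ℂ) (pt : ι → Z → ℂ),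
      (∀ μ ν : ι, MvPolynomial.eval (pt ν) (L μ) = if μ = ν then 1 else 0) →
      ∀ (y : ι → ℂ) (D : MvPolynomial ι ℂ),
        (∃ (S : Finset ι) (w : ι → ℂ), S.card ≤ t ∧ (∀ μ, μ ∉ S → w μ = 0) ∧
            MvPolynomial.eval (fun μ => y μ + w μ) D ≠ 0) →
        MvPolynomial.aeval (fun μ : ι => (C (y μ) : MvPolynomial (Fin t ⊕ (Fin t × Z)) ℂ) +
            ∑ j : Fin t, X (Sum.inl j) * rename (fun z => Sum.inr (j, z)) (L μ)) D ≠ 0) →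
    (∀ n : ℕ, ∃ ℓ : ℕ → Polynomial ℂ,
      ∀ k k' : ℕ, k ≤ n → k' ≤ n → (ℓ k).eval (k' : ℂ) = if k = k' then 1 else 0) →
    ∀ a : ℕ, ∃ n₀ : ℕ, ∀ n : ℕ, n₀ ≤ n →
      ∃ (t : ℕ) (Γ : degLEMonomials n → MvPolynomial (Fin t ⊕ (Fin t × Fin n)) ℂ),
        (∀ p : Fin t ⊕ (Fin t × Fin n) → ℂ, ∃ f ∈ SmallCircuits ℂ n 10,
            ∀ μ : degLEMonomials n,
              MvPolynomial.coeff (μ : Fin n →₀ ℕ) f = MvPolynomial.eval p (Γ μ)) ∧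
        ∀ D : MvPolynomial (degLEMonomials n) ℂ, D ≠ 0 →
          D.support.card ≤ Nat.choose (2 * n) n ^ a → MvPolynomial.aeval Γ D ≠ 0 := by
  intro hG1 hG2 hG3 a
  refine ⟨8 * a + 8, fun n hn => ?_⟩
  obtain ⟨ℓ, hℓ⟩ := hG3 n
  obtain ⟨f₀, hf₀, hfull⟩ := stub_fullSupport n (by omega)
  refine ⟨2 * a * n, fun μ => C (coeff (μ : Fin n →₀ ℕ) f₀) +
      ∑ j : Fin (2 * a * n), X (Sum.inl j) * rename (fun z => Sum.inr (j, z))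
        (∏ i : Fin n, Polynomial.aeval (X i : MvPolynomial (Fin n) ℂ) (ℓ ((μ : Fin n →₀ ℕ) i))),
    fun p => ?_, fun D hD0 hDa => ?_⟩
  · -- realisability: `Γ(p)` is the coefficient vector of `f₀ + Σ_j p(W_j) Λ_j`
    choose Λ hΛmem hΛcoeff using fun j : Fin (2 * a * n) =>
      hG1 n (by omega) (fun i k => (ℓ k).eval (p (Sum.inr (j, i))))
    refine ⟨f₀ + ∑ j : Fin (2 * a * n), C (p (Sum.inl j)) * Λ j,
      GeneratorGlue.add_sum_mem_smallCircuits (GeneratorGlue.size_budget hn) hf₀ hΛmem _,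
      fun μ => ?_⟩
    rw [GeneratorGlue.coeff_add_sum, GeneratorGlue.eval_generator]
    simp only [GeneratorGlue.eval_prod_aeval, hΛcoeff]
  · -- hitting: FSV Lemma 32 at `coeff f₀`, a supported non-root, then G2
    obtain ⟨m, hm, hmcard⟩ := Sparse.exists_narrow_monomial_shift hfull hD0
    have hcard : m.support.card ≤ 2 * a * n := GeneratorGlue.card_le_of_two_pow_le hmcard hDa
    obtain ⟨w, hw, hne⟩ := LowSupport.exists_eval_ne_zero_supported hm
    rw [ShiftedSupport.eval_shift] at hne
    exact hG2 (degLEMonomials n) (Fin n) (2 * a * n)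
      (fun μ => ∏ i : Fin n, Polynomial.aeval (X i : MvPolynomial (Fin n) ℂ) (ℓ ((μ : Fin n →₀ ℕ) i)))
      (fun ν i => (((ν : Fin n →₀ ℕ) i : ℕ) : ℂ)) (GeneratorGlue.eval_indicator hℓ)
      (fun μ => coeff (μ : Fin n →₀ ℕ) f₀) D ⟨m.support, w, hcard, hw, hne⟩

end Summit.ValiantsHypothesis.ValiantsHypothesis.Theorems.BarrierLever.SuccinctHittingSetsForVP
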